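/-
Copyright (c) 2026 the pub-hodgecm-mathlib formalisation cell (harness21).  Prover seat hodgecm-mathlib-K2Liu-p03 (g7): Track B «K2-LIT», hLiu418 = stmt-HodgeConjecture-24832,
socket #41, the I4 block, brick (D1) FILE 2 «THE CORNER-LINE INTEGRAL CONVERGES ON `0 < re s`» (LEAD F0P6-plan (g14) BATCH #82 (1); I4 desk K2E4-p11 (g8); road of K2Liu-p12 (g5)'s
(D1) census 22:36:25Z: the rank-one intertwining integral of the doubled LINE through ★ (T4-α) `blkD`).
-/
import Summits.HodgeConjecture.HodgeConjecture.Theorems.K2LiuIntertwiningConverges        -- ★ O41.3 `integrable_weylDelta_mul` (at the rank-one datum: `n := 1`, `½ < re (s + ½)`)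
import Summits.HodgeConjecture.HodgeConjecture.Theorems.K2LiuBlockDiagSectionPullback      -- ★ (T4-α) part 1 `isSiegelDeltaSection_comp_blkD_inr`, `continuous_comp_blkD_inr`
import Summits.HodgeConjecture.HodgeConjecture.Theorems.K2LiuCornerLineChartTwo            -- ★ (T4-α) part 3 `iotaGG_one_eq_blkD_weylDelta` (`w₀ = blkD (1, w_Δ⁽¹⁾)`)
import Summits.HodgeConjecture.HodgeConjecture.Theorems.K2LiuCornerLineChartTwoInl         -- ★ (T4) `inl` TWIN `iotaGG_one_eq_blkD_weylDelta_inl` (`e (1,0) = 0`; F0P2-p11) — ED. 2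
import Summits.HodgeConjecture.HodgeConjecture.Theorems.K2LiuIwasawaHeightContinuous        -- ★ `continuous_iwasawaHeight`, `iwasawaHeight_delta_mul` (§2)
import HarnessLib

/-!
# Crux `HLiu418`, socket #41, I4 block, (D1) FILE 2: THE CORNER-LINE INTEGRAL OF A SIEGEL SECTION CONVERGES ON `0 < re s` — it is the rank-one intertwining
# integral of the doubled LINE at `s + ½`, through ★ (T4-α)'s block-diagonal embedding `blkD`

Cell `hodgecm-mathlib`, crux item hLiu418 = `stmt-HodgeConjecture-24832`; squad K2 ∕ K2Liu; prover K2Liu-p03 (g7) (LEAD F0P6-plan (g14) BATCH #82 (1); I4 desk K2E4-p11 (g8)).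
THEOREMS ONLY (no `def`, no instance, no notation, no named-fact hypothesis, no `sorry`); lane `--supports stmt-HodgeConjecture-24832 --as helper`.

THE MATHEMATICS [KudlaRallis1994, §2 (2.10)–(2.12)], [MoeglinWaldspurger1995, II.1.6–II.1.7], [Tan1999, §1, §4 Prop. 4.8].  `n = 2`, `V = V₁ ⊕ V₂` the two lines (`N = 1 + 1`,
`M = 1`, the corner hypothesis `he : e (1,0) = 1`), `w₀ = ι(1, g₀)` the middle Weyl element.  By ★ (T4-α) part 3 `w₀ = blkD (1, w_Δ⁽ᴮ⁾)` and the corner line is `n₂(t) = blkD (1, n⁽ᴮ⁾(t))`,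
`n⁽ᴮ⁾` the Siegel unipotent chart of the doubled LINE `H(V₂) = U(𝕍₂ ⊕ −𝕍₂)`; by ★ (T4-α) part 1 a Siegel section `f ∈ I_Δ^{(V)}(s, χ)` pulls back along `y ↦ blkD (1, y) · g` to a
continuous Siegel section of `I_Δ^{(V₂)}(s + ½, χ)`.  Hence `t ↦ f(w₀ · n₂(t) · g) = (f ∘ blkD(1, ·) g)(w_Δ⁽ᴮ⁾ · n⁽ᴮ⁾(t))` is the INTERTWINING INTEGRAND OF THE DOUBLED LINE at `s + ½`, integrable
by ★ O41.3 `integrable_weylDelta_mul` at `n := 1` exactly when `½ < re (s + ½)`, i.e. **`0 < re s`** — the half-plane of ★ I4's `hint` ∕ `hFhol`.  HYPOTHESIS-FIRST on the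
LINE CHART (as ★ (T4-β) `K2LiuCornerLineWhittaker`): the chart `nB : T → N_Δ⁽ᴮ⁾(𝔸)` on the parameter space `(T, μ)` with a HAAR push-forward `map nB μ` and the identity
`n₂ t = blkD (1, nB t)` are taken BY VALUE (the line chart of record `𝔸_{L⁺} ≅ N_Δ⁽ᴮ⁾(𝔸)`, ★ `exists_unipChart` at the line datum, discharges them — F0P2-p11 (g2)'s
`K2LiuLineCornerChart`).
* §1 **`integrable_cornerLine_section`** — `0 < re s`, `χ` unitary, `f ∈ I_Δ(s, χ)` continuous, ANY translate `y`: `Integrable (t ↦ f(ι(1,g₀) · (n₂ t · y))) μ`.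
* §2 **`integrable_cornerLine_height`** — the HEIGHT LETTER `hJ` of ★ (D1) FILE 1 `K2LiuSiegelMiddleTermCornerMajorant.hint_and_hFhol_of_cornerHeight` on the chart:
  `∀ σ > 0, Integrable (t ↦ H_𝒦(ι(1,g₀) · n₂ t)^{2σ+2}) μ` (§1 at the continuous Siegel section `h ↦ H_𝒦(h)^{2σ+2}` of `I_Δ(σ, 𝟙)`: `isSiegelDeltaSection_height_cpow`).
* §3 (ED. 2) **THE OTHER ORIENTATION `e (1,0) = 0`** (I4 desk K2E4-p11 (g8): the socket's frame is arbitrary): `integrable_cornerLine_section_inl` ∕ `integrable_cornerLine_height_inl` — the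
  corner on the FIRST summand, chart `nA`, `n₂ t = blkD (nA t, 1)`, `w₀ = blkD (w_Δ⁽ᴬ⁾, 1)` (★ `K2LiuCornerLineChartTwoInl.iotaGG_one_eq_blkD_weylDelta_inl`, F0P2-p11), pull-back ★ `…_comp_blkD_inl`.
HONEST LABEL.  Count-neutral helper: `HC_CM` is proved only modulo the 7 printed citations (2 remaining named inputs: hLiu418 = `stmt-HodgeConjecture-24832`,
h413 = `stmt-HodgeConjecture-24833`) until rung 0 closes.
-/

set_option autoImplicit false
set_option linter.dupNamespace false -- the mandated namespace repeats `HodgeConjecture.HodgeConjecture`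

noncomputable section

open scoped Matrix ENNReal NNReal
open NumberField IsDedekindDomain MeasureTheory MeasureTheory.Measure Filter Topology
open Literature.NumberTheory.Automorphic Literature.NumberTheory.Automorphic.UnitaryGroup Literature.NumberTheory.GaloisRepresentations
open Literature.NumberTheory.GelbartRogawski1991 Literature.NumberTheory.GelbartRogawski1991.GRConstruction
open Literature.NumberTheory.K2Lit.SiegelDoubled
open UnitaryDualPair
open Summit.HodgeConjecture.HodgeConjecture.Cruxes.HLiu418.K2LiuIntertwiningConverges (integrable_weylDelta_mul)
open Summit.HodgeConjecture.HodgeConjecture.Cruxes.HLiu418.K2LiuBlockDiagSectionPullback (isSiegelDeltaSection_comp_blkD_inr continuous_comp_blkD_inr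
  isSiegelDeltaSection_comp_blkD_inl continuous_comp_blkD_inl)
open Summit.HodgeConjecture.HodgeConjecture.Cruxes.HLiu418.K2LiuCornerLineChartTwo (iotaGG_one_eq_blkD_weylDelta)
open Summit.HodgeConjecture.HodgeConjecture.Cruxes.HLiu418.K2LiuCornerLineChartTwoInl (iotaGG_one_eq_blkD_weylDelta_inl)
open Summit.HodgeConjecture.HodgeConjecture.Cruxes.HLiu418.K2LiuIwasawaHeightContinuous (continuous_iwasawaHeight iwasawaHeight_delta_mul)

namespace Summit.HodgeConjecture.HodgeConjecture.Cruxes.HLiu418.K2LiuCornerLineSectionIntegrable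

variable (L : Type) [Field L] [NumberField L] [IsCMField L]

/-! ## §0 A real-valued height power is a Siegel section of `I_Δ(σ, 𝟙)` (generic datum) -/

section Height

variable {N M n : ℕ} (e : Fin N × Fin M ≃ Fin n)
  (dV : Fin N → L) (hdV : ∀ i, IsCMField.complexConj L (dV i) = dV i) (hdV0 : ∀ i, dV i ≠ 0)
  (dW : Fin M → L) (hdW : ∀ i, IsCMField.complexConj L (dW i) = dW i) (hdW0 : ∀ i, dW i ≠ 0)

/-- `σ_{1,s}(p) = modΔ(p)^{2s+n}` (the trivial character: `chiDet 1 = 1`). [cite: Tan1999, §1] -/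
theorem siegelDeltaCharacter_one (s : ℂ) (p : HA L e dV hdV dW hdW) :
    siegelDeltaCharacter L e dV hdV dW hdW 1 s p = ((modDelta L e dV hdV dW hdW p : ℝ) : ℂ) ^ (2 * s + (n : ℂ)) := by
  have h1 : chiDet L e dV hdV dW hdW (1 : HeckeCharacter L) p = 1 := by
    unfold chiDet
    split_ifs <;> rfl
  rw [siegelDeltaCharacter, h1, Units.val_one, one_mul]

include hdV0 hdW0 in
/-- **`h ↦ H_𝒦(h)^{2σ+n}` IS A CONTINUOUS SIEGEL SECTION OF `I_Δ(σ, 𝟙)`** (`H_𝒦 = modΔ ∘ pPart`: `H_𝒦(p h) = modΔ(p)·H_𝒦(h)` ★ `iwasawaHeight_delta_mul`; continuity ★ `continuous_iwasawaHeight`).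
[cite: MoeglinWaldspurger1995, II.1.5–II.1.6] [cite: Garrett2018, §3.10] -/
theorem isSiegelDeltaSection_height_cpow (𝒦 : IwasawaDatum L e dV hdV dW hdW) (σ : ℝ) :
    IsSiegelDeltaSection L e dV hdV dW hdW 1 (σ : ℂ) (fun h => ((modDelta L e dV hdV dW hdW (𝒦.pPart h) : ℝ) : ℂ) ^ (2 * (σ : ℂ) + (n : ℂ))) ∧
      Continuous (fun h => ((modDelta L e dV hdV dW hdW (𝒦.pPart h) : ℝ) : ℂ) ^ (2 * (σ : ℂ) + (n : ℂ))) := by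
  refine ⟨fun p hp h => ?_, ?_⟩
  · show ((modDelta L e dV hdV dW hdW (𝒦.pPart (p * h)) : ℝ) : ℂ) ^ (2 * (σ : ℂ) + (n : ℂ)) =
      siegelDeltaCharacter L e dV hdV dW hdW 1 σ p * ((modDelta L e dV hdV dW hdW (𝒦.pPart h) : ℝ) : ℂ) ^ (2 * (σ : ℂ) + (n : ℂ))
    rw [iwasawaHeight_delta_mul L e dV hdV hdV0 dW hdW hdW0 𝒦 hp h, Complex.ofReal_mul,
      Complex.mul_cpow_ofReal_nonneg (modDelta_pos L e dV hdV dW hdW _).le (modDelta_pos L e dV hdV dW hdW _).le, siegelDeltaCharacter_one]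
  · exact ((Complex.continuous_ofReal.comp (continuous_iwasawaHeight L e dV hdV hdV0 dW hdW hdW0 𝒦)).cpow continuous_const
      fun _ => Complex.ofReal_mem_slitPlane.2 (modDelta_pos L e dV hdV dW hdW _))

/-- `‖(H : ℂ)^{2σ+n}‖ = H^{2σ+n}` for `H > 0`, `σ` real. [folklore] -/
theorem norm_ofReal_cpow_two_mul_add {H : ℝ} (hH : 0 < H) (σ : ℝ) :
    ‖((H : ℝ) : ℂ) ^ (2 * (σ : ℂ) + (n : ℂ))‖ = H ^ (2 * σ + (n : ℝ)) := by
  rw [Complex.norm_cpow_eq_rpow_re_of_pos hH]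
  congr 1
  simp [Complex.add_re, Complex.mul_re]

end Height

/-! ## §1 The corner-line integral of a Siegel section converges on `0 < re s` (the datum of ★ (T4-α) part 3: `n = 2`, `V = V₁ ⊕ V₂` two lines) -/

variable {k₁ k₂ : ℕ} (e : Fin (1 + 1) × Fin 1 ≃ Fin 2) (eA : Fin 1 × Fin 1 ≃ Fin k₁) (eB : Fin 1 × Fin 1 ≃ Fin k₂)
  (dA : Fin 1 → L) (hdA : ∀ i, IsCMField.complexConj L (dA i) = dA i)
  (dB : Fin 1 → L) (hdB : ∀ i, IsCMField.complexConj L (dB i) = dB i) (hdB0 : ∀ i, dB i ≠ 0)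
  (dV : Fin (1 + 1) → L) (hdV : ∀ i, IsCMField.complexConj L (dV i) = dV i) (hdV0 : ∀ i, dV i ≠ 0)
  (hVA : ∀ i, dV (Fin.castAdd 1 i) = dA i) (hVB : ∀ j, dV (Fin.natAdd 1 j) = dB j)
  (dW : Fin 1 → L) (hdW : ∀ i, IsCMField.complexConj L (dW i) = dW i) (hdW0 : ∀ i, dW i ≠ 0)

omit [NumberField L] [IsCMField L] in
include eA in
/-- `k₁ = 1` (one line, one partner line). [folklore] -/
theorem k₁_eq_one : k₁ = 1 := by
  have h := Fintype.card_congr eA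
  simp only [Fintype.card_prod, Fintype.card_fin, mul_one] at h
  exact h.symm

omit [NumberField L] [IsCMField L] in
include eB in
/-- `k₂ = 1`. [folklore] -/
theorem k₂_eq_one : k₂ = 1 := by
  have h := Fintype.card_congr eB
  simp only [Fintype.card_prod, Fintype.card_fin, mul_one] at h
  exact h.symm

include hdB0 hdW0 in
/-- **(D1) THE CORNER-LINE INTEGRAL OF A SIEGEL SECTION CONVERGES ON `0 < re s`.**  `n = 2`, `V = V₁ ⊕ V₂` the two lines under the corner hypothesis `he : e (1,0) = 1`, `w₀ = ι(1, g₀)`;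
a parameter space `(T, μ)` with a measurable LINE CHART `nB : T → N_Δ⁽ᴮ⁾(𝔸)` whose push-forward `map nB μ` is a Haar measure, and the corner line `n₂ t = blkD (1, nB t)` BY VALUE;
`χ` unitary, `0 < re s`, `f ∈ I_Δ^{(V)}(s, χ)` a continuous Siegel section, ANY translate `y ∈ H(V)(𝔸)`.  Then `t ↦ f(w₀ · (n₂ t · y))` is `μ`-integrable: `w₀ · n₂ t = blkD (1, w_Δ⁽ᴮ⁾ · nB t)`
(★ `iotaGG_one_eq_blkD_weylDelta`, `blkD` a homomorphism), `f(blkD(1, ·) · y) ∈ I_Δ^{(V₂)}(s + ½, χ)` continuous (★ (T4-α) part 1), and ★ O41.3 `integrable_weylDelta_mul` at the doubled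
LINE (`n := 1`, `½ < re (s + ½)`) along the chart. [cite: KudlaRallis1994, §2 (2.10)–(2.12)] [cite: MoeglinWaldspurger1995, II.1.6–II.1.7] [cite: Tan1999, §4 Prop. 4.8] -/
theorem integrable_cornerLine_section (he : e (1, 0) = 1)
    {g₀ : UnitaryGroup.rationalPair (Fp L) L (IsCMField.complexConj L) (1 + 1) 1 (Matrix.diagonal dV) (Matrix.diagonal dW)}
    (hg₀ : ((g₀ : GL (Fin (1 + 1) × Fin 1) L) : Matrix (Fin (1 + 1) × Fin 1) (Fin (1 + 1) × Fin 1) L) = Matrix.diagonal (fun k => 1 - 2 * (![0, 1] : Fin 2 → L) (e k)))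
    [MeasurableSpace (unipDelta L eB dB hdB dW hdW)] [BorelSpace (unipDelta L eB dB hdB dW hdW)]
    {T : Type*} [MeasurableSpace T] (μ : Measure T)
    (nB : T → unipDelta L eB dB hdB dW hdW) (hnB : AEMeasurable nB μ) (hHaar : (Measure.map nB μ).IsHaarMeasure)
    (n₂ : T → HA L e dV hdV dW hdW) (hn₂ : ∀ t, n₂ t = blkD L e eA eB dA hdA dB hdB dV hdV hVA hVB dW hdW (1, (nB t : HA L eB dB hdB dW hdW)))
    {χ : HeckeCharacter L} (hχ : χ.IsUnitary) {s : ℂ} (hs : 0 < s.re)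
    {f : HA L e dV hdV dW hdW → ℂ} (hf : IsSiegelDeltaSection L e dV hdV dW hdW χ s f) (hfc : Continuous f) (y : HA L e dV hdV dW hdW) :
    Integrable (fun t => f (iotaGG L e dV hdV dW hdW (1, UnitaryGroup.rationalPairToAdelic (Fp L) L (IsCMField.complexConj L) (1 + 1) 1 (Matrix.diagonal dV) (Matrix.diagonal dW) g₀) *
      (n₂ t * y))) μ := by
  haveI := hHaar
  have hk₁ : k₁ = 1 := k₁_eq_one eA
  have hk₂ : k₂ = 1 := k₂_eq_one eB
  -- the pulled-back section of the doubled line at `s + ½`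
  have hg := isSiegelDeltaSection_comp_blkD_inr L e eA eB dA hdA dB hdB dV hdV hVA hVB dW hdW hf y
  have hgc := continuous_comp_blkD_inr L e eA eB dA hdA dB hdB dV hdV hVA hVB dW hdW hfc y
  have hs' : (k₂ : ℝ) / 2 < (s + (k₁ : ℂ) / 2).re := by
    rw [hk₁, hk₂]
    simp only [Nat.cast_one, Complex.add_re, Complex.div_ofNat_re, Complex.one_re]
    linarith
  -- ★ O41.3 at the doubled line, for the Haar measure `map nB μ`, at the translate `1`
  have hG := integrable_weylDelta_mul L eB dB hdB dW hdW hdB0 hdW0 hχ hs' hg hgc (Measure.map nB μ) 1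
  -- pull back along the chart
  have hGm : AEStronglyMeasurable (fun u : unipDelta L eB dB hdB dW hdW =>
      f (blkD L e eA eB dA hdA dB hdB dV hdV hVA hVB dW hdW (1, weylDelta L eB dB hdB dW hdW * (u : HA L eB dB hdB dW hdW) * 1) * y)) (Measure.map nB μ) :=
    (hgc.comp ((continuous_const.mul continuous_subtype_val).mul continuous_const)).aestronglyMeasurable
  have hcomp := (integrable_map_measure hGm hnB).1 hG
  refine hcomp.congr (Eventually.of_forall fun t => ?_)
  simp only [Function.comp_apply, mul_one]
  rw [hn₂ t, iotaGG_one_eq_blkD_weylDelta L e eA eB dA hdA dB hdB dV hdV hVA hVB dW hdW he hg₀, ← mul_assoc, ← map_mul, Prod.mk_mul_mk, mul_one]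

/-! ## §2 The height letter `hJ` of ★ (D1) FILE 1 on the chart -/

include hdB0 hdW0 hdV0 in
/-- **(D1) THE CORNER-LINE HEIGHT INTEGRAL**: on the chart of §1, for every `σ > 0` and every Iwasawa datum `𝒦` of `H(V)(𝔸)`, `t ↦ H_𝒦(w₀ · n₂ t)^{2σ+2}` is `μ`-integrable (§1 at the
continuous Siegel section `h ↦ H_𝒦(h)^{2σ+2}` of `I_Δ(σ, 𝟙)`, translate `y = 1`) — the letter `hJ` of ★ `K2LiuSiegelMiddleTermCornerMajorant.hint_and_hFhol_of_cornerHeight` on the chart.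
[cite: KudlaRallis1994, §2 (2.10)–(2.12)] [cite: MoeglinWaldspurger1995, II.1.6] [cite: Garrett2018, §3.10] -/
theorem integrable_cornerLine_height (he : e (1, 0) = 1)
    {g₀ : UnitaryGroup.rationalPair (Fp L) L (IsCMField.complexConj L) (1 + 1) 1 (Matrix.diagonal dV) (Matrix.diagonal dW)}
    (hg₀ : ((g₀ : GL (Fin (1 + 1) × Fin 1) L) : Matrix (Fin (1 + 1) × Fin 1) (Fin (1 + 1) × Fin 1) L) = Matrix.diagonal (fun k => 1 - 2 * (![0, 1] : Fin 2 → L) (e k)))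
    [MeasurableSpace (unipDelta L eB dB hdB dW hdW)] [BorelSpace (unipDelta L eB dB hdB dW hdW)]
    {T : Type*} [MeasurableSpace T] (μ : Measure T)
    (nB : T → unipDelta L eB dB hdB dW hdW) (hnB : AEMeasurable nB μ) (hHaar : (Measure.map nB μ).IsHaarMeasure)
    (n₂ : T → HA L e dV hdV dW hdW) (hn₂ : ∀ t, n₂ t = blkD L e eA eB dA hdA dB hdB dV hdV hVA hVB dW hdW (1, (nB t : HA L eB dB hdB dW hdW)))
    (𝒦 : IwasawaDatum L e dV hdV dW hdW) {σ : ℝ} (hσ : 0 < σ) :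
    Integrable (fun t => modDelta L e dV hdV dW hdW (𝒦.pPart
      (iotaGG L e dV hdV dW hdW (1, UnitaryGroup.rationalPairToAdelic (Fp L) L (IsCMField.complexConj L) (1 + 1) 1 (Matrix.diagonal dV) (Matrix.diagonal dW) g₀) * n₂ t)) ^
        (2 * σ + (2 : ℝ))) μ := by
  obtain ⟨hsec, hcont⟩ := isSiegelDeltaSection_height_cpow L e dV hdV hdV0 dW hdW hdW0 𝒦 σ
  have hs : 0 < ((σ : ℂ)).re := by rwa [Complex.ofReal_re]
  have h := (integrable_cornerLine_section L e eA eB dA hdA dB hdB hdB0 dV hdV hVA hVB dW hdW hdW0 he hg₀ μ nB hnB hHaar n₂ hn₂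
    HeckeCharacter.isUnitary_one hs hsec hcont 1).norm
  refine h.congr (Eventually.of_forall fun t => ?_)
  simp only [mul_one]
  rw [norm_ofReal_cpow_two_mul_add (modDelta_pos L e dV hdV dW hdW _), Nat.cast_ofNat]

/-! ## §3 (ED. 2) The other orientation `e (1,0) = 0`: the corner on the FIRST summand -/

include hdW0 in
/-- **(D1) THE CORNER-LINE INTEGRAL CONVERGES ON `0 < re s` — ORIENTATION `e (1,0) = 0`** (the Gram corner index `1` is the FIRST line `dA = dV ∘ castAdd 1`): a measurable chart
`nA : T → N_Δ⁽ᴬ⁾(𝔸)` with Haar push-forward and `n₂ t = blkD (nA t, 1)` BY VALUE; then `t ↦ f(ι(1,g₀) · (n₂ t · y))` is `μ`-integrable for every continuous Siegel section `f ∈ I_Δ(s,χ)`,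
`χ` unitary, `0 < re s`, every `y` (`ι(1,g₀) = blkD (w_Δ⁽ᴬ⁾, 1)` ★ `iotaGG_one_eq_blkD_weylDelta_inl`; pull-back ★ `isSiegelDeltaSection_comp_blkD_inl` at `s + ½`; ★ O41.3 at the line `V₁`).
[cite: KudlaRallis1994, §2 (2.10)–(2.12)] [cite: MoeglinWaldspurger1995, II.1.6–II.1.7] [cite: Tan1999, §4 Prop. 4.8] -/
theorem integrable_cornerLine_section_inl (he : e (1, 0) = 0) (hdA0 : ∀ i, dA i ≠ 0)
    {g₀ : UnitaryGroup.rationalPair (Fp L) L (IsCMField.complexConj L) (1 + 1) 1 (Matrix.diagonal dV) (Matrix.diagonal dW)}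
    (hg₀ : ((g₀ : GL (Fin (1 + 1) × Fin 1) L) : Matrix (Fin (1 + 1) × Fin 1) (Fin (1 + 1) × Fin 1) L) = Matrix.diagonal (fun k => 1 - 2 * (![0, 1] : Fin 2 → L) (e k)))
    [MeasurableSpace (unipDelta L eA dA hdA dW hdW)] [BorelSpace (unipDelta L eA dA hdA dW hdW)]
    {T : Type*} [MeasurableSpace T] (μ : Measure T)
    (nA : T → unipDelta L eA dA hdA dW hdW) (hnA : AEMeasurable nA μ) (hHaar : (Measure.map nA μ).IsHaarMeasure)
    (n₂ : T → HA L e dV hdV dW hdW) (hn₂ : ∀ t, n₂ t = blkD L e eA eB dA hdA dB hdB dV hdV hVA hVB dW hdW ((nA t : HA L eA dA hdA dW hdW), 1))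
    {χ : HeckeCharacter L} (hχ : χ.IsUnitary) {s : ℂ} (hs : 0 < s.re)
    {f : HA L e dV hdV dW hdW → ℂ} (hf : IsSiegelDeltaSection L e dV hdV dW hdW χ s f) (hfc : Continuous f) (y : HA L e dV hdV dW hdW) :
    Integrable (fun t => f (iotaGG L e dV hdV dW hdW (1, UnitaryGroup.rationalPairToAdelic (Fp L) L (IsCMField.complexConj L) (1 + 1) 1 (Matrix.diagonal dV) (Matrix.diagonal dW) g₀) *
      (n₂ t * y))) μ := by
  haveI := hHaar
  have hk₁ : k₁ = 1 := k₁_eq_one eA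
  have hk₂ : k₂ = 1 := k₂_eq_one eB
  -- the pulled-back section of the doubled FIRST line at `s + ½`
  have hg := isSiegelDeltaSection_comp_blkD_inl L e eA eB dA hdA dB hdB dV hdV hVA hVB dW hdW hf y
  have hgc := continuous_comp_blkD_inl L e eA eB dA hdA dB hdB dV hdV hVA hVB dW hdW hfc y
  have hs' : (k₁ : ℝ) / 2 < (s + (k₂ : ℂ) / 2).re := by
    rw [hk₁, hk₂]
    simp only [Nat.cast_one, Complex.add_re, Complex.div_ofNat_re, Complex.one_re]
    linarith
  have hG := integrable_weylDelta_mul L eA dA hdA dW hdW hdA0 hdW0 hχ hs' hg hgc (Measure.map nA μ) 1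
  have hGm : AEStronglyMeasurable (fun u : unipDelta L eA dA hdA dW hdW =>
      f (blkD L e eA eB dA hdA dB hdB dV hdV hVA hVB dW hdW (weylDelta L eA dA hdA dW hdW * (u : HA L eA dA hdA dW hdW) * 1, 1) * y)) (Measure.map nA μ) :=
    (hgc.comp ((continuous_const.mul continuous_subtype_val).mul continuous_const)).aestronglyMeasurable
  have hcomp := (integrable_map_measure hGm hnA).1 hG
  refine hcomp.congr (Eventually.of_forall fun t => ?_)
  simp only [Function.comp_apply, mul_one]
  rw [hn₂ t, iotaGG_one_eq_blkD_weylDelta_inl L e eA eB dA hdA dB hdB dV hdV hVA hVB dW hdW he hg₀, ← mul_assoc, ← map_mul, Prod.mk_mul_mk, mul_one]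

include hdW0 hdV0 in
/-- **(D1) THE CORNER-LINE HEIGHT INTEGRAL — ORIENTATION `e (1,0) = 0`**: on the chart of `integrable_cornerLine_section_inl`, `t ↦ H_𝒦(w₀ · n₂ t)^{2σ+2}` is `μ`-integrable for `σ > 0`.
[cite: KudlaRallis1994, §2 (2.10)–(2.12)] [cite: MoeglinWaldspurger1995, II.1.6] [cite: Garrett2018, §3.10] -/
theorem integrable_cornerLine_height_inl (he : e (1, 0) = 0) (hdA0 : ∀ i, dA i ≠ 0)
    {g₀ : UnitaryGroup.rationalPair (Fp L) L (IsCMField.complexConj L) (1 + 1) 1 (Matrix.diagonal dV) (Matrix.diagonal dW)}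
    (hg₀ : ((g₀ : GL (Fin (1 + 1) × Fin 1) L) : Matrix (Fin (1 + 1) × Fin 1) (Fin (1 + 1) × Fin 1) L) = Matrix.diagonal (fun k => 1 - 2 * (![0, 1] : Fin 2 → L) (e k)))
    [MeasurableSpace (unipDelta L eA dA hdA dW hdW)] [BorelSpace (unipDelta L eA dA hdA dW hdW)]
    {T : Type*} [MeasurableSpace T] (μ : Measure T)
    (nA : T → unipDelta L eA dA hdA dW hdW) (hnA : AEMeasurable nA μ) (hHaar : (Measure.map nA μ).IsHaarMeasure)
    (n₂ : T → HA L e dV hdV dW hdW) (hn₂ : ∀ t, n₂ t = blkD L e eA eB dA hdA dB hdB dV hdV hVA hVB dW hdW ((nA t : HA L eA dA hdA dW hdW), 1))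
    (𝒦 : IwasawaDatum L e dV hdV dW hdW) {σ : ℝ} (hσ : 0 < σ) :
    Integrable (fun t => modDelta L e dV hdV dW hdW (𝒦.pPart
      (iotaGG L e dV hdV dW hdW (1, UnitaryGroup.rationalPairToAdelic (Fp L) L (IsCMField.complexConj L) (1 + 1) 1 (Matrix.diagonal dV) (Matrix.diagonal dW) g₀) * n₂ t)) ^
        (2 * σ + (2 : ℝ))) μ := by
  obtain ⟨hsec, hcont⟩ := isSiegelDeltaSection_height_cpow L e dV hdV hdV0 dW hdW hdW0 𝒦 σ
  have hs : 0 < ((σ : ℂ)).re := by rwa [Complex.ofReal_re]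
  have h := (integrable_cornerLine_section_inl L e eA eB dA hdA dB hdB dV hdV hVA hVB dW hdW hdW0 he hdA0 hg₀ μ nA hnA hHaar n₂ hn₂
    HeckeCharacter.isUnitary_one hs hsec hcont 1).norm
  refine h.congr (Eventually.of_forall fun t => ?_)
  simp only [mul_one]
  rw [norm_ofReal_cpow_two_mul_add (modDelta_pos L e dV hdV dW hdW _), Nat.cast_ofNat]

end Summit.HodgeConjecture.HodgeConjecture.Cruxes.HLiu418.K2LiuCornerLineSectionIntegrable

end
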